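import Literature.AnabelianGeometry.SemiGraphs.TemperedAnabelianThm68ivTransportLemmas
import Literature.AnabelianGeometry.SemiGraphs.TemperedDLocTransportEquivalence

/-!
# [SemiAnbd] Thm. 6.8 (iv) re-cut, proof plumbing II: OF-type of realised arrows, transport of the tripod object

Mochizuki, *Semi-graphs of anabelioids* [SemiAnbd], §6 Thm. 6.8 (ii)/(iv), ms. pp. 74–75; [GalSect] Rmk. 2.8.1
(ms. p. 12: arrows of OF-type are transported «without using Theorem 1.2 at all»), Cor. 2.8 proof p. 11
(«both curves admit a [cuspidally split] tripod as an HPC»). [cite: MochizukiSemiAnbd2006, Thm 6.8 pp.74-75]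
[cite: MochizukiGalSect2005, Rmk 2.8.1 p.12]

Proof-only companion (abc-iut cell, layer L3, seat abc-iut-L3-t7; row «Q-IV·TRIPOD-DESCENT»), continuing
`TemperedAnabelianThm68ivTransportLemmas.lean`:
* `isOFTypeRep_rep` — the chosen transported representative `ρ` between on-the-nose realisations is of OF-type
  (T68-R1) when the original is (T68-R2 `ofRepsTransported_holds` + invariance under the identifications `J ≅ J`
  of objects with equal `(H, N)`);
* `exists_conj_rep` — any representative of `π₁(χ)` is compatible with the scheme-side `π₁(χ)` up to inner;
* `isTripodObj_transport`, `isTripodObj_congr` — a tripod object goes to a tripod object (`Δ ≤ H` by (hΔ), the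
  three surviving classes of cuspidal geometric decomposition groups by Thm. 6.5 (iii) in both directions).
Nothing of [SemiAnbd]/[GalSect] is asserted; nothing here takes a side on [IUTchIII] Cor. 3.12.
-/

noncomputable section

namespace Literature.AnabelianGeometry.SemiGraphs

open scoped Pointwise
open CategoryTheory Topology

variable {p : ℕ} [Fact p.Prime]

namespace Thm68Sub

/-! ### Any representative is compatible with the scheme-side `π₁` up to inner -/

section AnyRep

variable {X : TemperedCurve p} (D : DLocSchemeData X)

/-- Every representative `φ` of `π₁(χ)` (not only the one supplied by `map_objIso`) satisfies
`objIso ∘ φ = Inn(c) ∘ π₁(χ) ∘ objIso` for some `c`. [cite: MochizukiSemiAnbd2006, §6 p.74] -/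
theorem exists_conj_rep {P Q : D.DLocK} (χ : letI := D.catK; P ⟶ Q)
    (φ : letI := D.catK; letI := DLocObj.dlocCategory X; DLocObj.HomRep (D.pi1Functor.obj P) (D.pi1Functor.obj Q))
    (hφ : letI := D.catK; letI := DLocObj.dlocCategory X; D.pi1Functor.map χ = DLocObj.homMk φ) :
    letI := D.catK; letI := DLocObj.dlocCategory X
    ∃ c : (D.curve Q).PiTemp, ∀ j, D.objIso Q (φ.toHom j) = c * D.pi1 χ (D.objIso P j) * c⁻¹ := by
  letI := D.catK; letI := DLocObj.dlocCategory X
  obtain ⟨φ₀, hφ₀, c₀, hc₀⟩ := D.map_objIso χ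
  obtain ⟨b, hb⟩ := exists_conj_of_homMk_eq (hφ₀.symm.trans hφ)
  -- `hb : ∀ j, φ j = b * φ₀ j * b⁻¹`
  refine ⟨D.objIso Q b * c₀, fun j => ?_⟩
  rw [hb, map_mul, map_mul, map_inv, hc₀]
  group

end AnyRep

/-! ### OF-type of the chosen transported representative -/

section OFType

variable {X Y : TemperedCurve p} (DXs : DLocSchemeData X) (DYs : DLocSchemeData Y)
  (α : X.PiTemp ≃ₜ* Y.PiTemp)
  (hI : ∀ I : Subgroup X.PiTemp, X.IsCuspidalGeometricDecompositionGroup I →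
    Y.IsCuspidalGeometricDecompositionGroup (I.map α.toMulEquiv.toMonoidHom))
  (hΔ : X.DeltaTemp.map α.toMulEquiv.toMonoidHom = Y.DeltaTemp)

/-- The identification `J_A ⥲ J_B` of two objects with the same `(H, N)` carries the generating set of images of
a family `gens` of subgroups in `J_A` onto the corresponding set in `J_B`. [cite: MochizukiSemiAnbd2006, §6 p.74] -/
theorem image_jEquivOfEq_gens (A B : DLocObj Y) (hH : A.H = B.H) (hN : A.N = B.N)
    (gens : Set (Subgroup Y.PiTemp)) :
    (jEquivOfEq A B hH hN) ''
        (⋃ I ∈ gens, (((I.subgroupOf A.H).map A.proj.toMonoidHom : Subgroup A.J) : Set A.J)) =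
      ⋃ I ∈ gens, (((I.subgroupOf B.H).map B.proj.toMonoidHom : Subgroup B.J) : Set B.J) := by
  ext y
  simp only [Set.mem_image, Set.mem_iUnion, SetLike.mem_coe, Subgroup.mem_map, Subgroup.mem_subgroupOf,
    exists_prop]
  constructor
  · rintro ⟨j, ⟨I, hIg, h, hh, rfl⟩, rfl⟩
    exact ⟨I, hIg, MulEquiv.subgroupCongr hH h, hh, (jEquivOfEq_mk A B hH hN h).symm⟩
  · rintro ⟨I, hIg, h, hh, rfl⟩
    refine ⟨A.proj ((MulEquiv.subgroupCongr hH).symm h), ⟨I, hIg, (MulEquiv.subgroupCongr hH).symm h, hh, rfl⟩, ?_⟩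
    rw [jEquivOfEq_mk, MulEquiv.apply_symm_apply]
    rfl

/-- **OF-type is preserved**: if `φ` is of OF-type (T68-R1 `IsOFTypeRep`), so is the chosen transported
representative `ρ` between on-the-nose realisations ([GalSect] Rmk. 2.8.1; T68-R2 `ofRepsTransported_holds`
composed with the identifications of objects with equal `(H, N)`). [cite: MochizukiGalSect2005, Rmk 2.8.1 p.12] -/
theorem isOFTypeRep_rep {P Q : DXs.DLocK} {P' Q' : DYs.DLocK}
    (hHP : letI := DXs.catK; letI := DYs.catK; letI := DLocObj.dlocCategory X; letI := DLocObj.dlocCategory Y;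
      (DYs.pi1Functor.obj P').H = ((DXs.pi1Functor.obj P).transport α hI hΔ).H)
    (hNP : letI := DXs.catK; letI := DYs.catK; letI := DLocObj.dlocCategory X; letI := DLocObj.dlocCategory Y;
      (DYs.pi1Functor.obj P').N = ((DXs.pi1Functor.obj P).transport α hI hΔ).N)
    (hHQ : letI := DXs.catK; letI := DYs.catK; letI := DLocObj.dlocCategory X; letI := DLocObj.dlocCategory Y;
      (DYs.pi1Functor.obj Q').H = ((DXs.pi1Functor.obj Q).transport α hI hΔ).H)
    (hNQ : letI := DXs.catK; letI := DYs.catK; letI := DLocObj.dlocCategory X; letI := DLocObj.dlocCategory Y;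
      (DYs.pi1Functor.obj Q').N = ((DXs.pi1Functor.obj Q).transport α hI hΔ).N)
    {φ : letI := DXs.catK; letI := DLocObj.dlocCategory X;
      DLocObj.HomRep (DXs.pi1Functor.obj P) (DXs.pi1Functor.obj Q)}
    {ρ : letI := DYs.catK; letI := DLocObj.dlocCategory Y;
      DLocObj.HomRep (DYs.pi1Functor.obj P') (DYs.pi1Functor.obj Q')}
    (hρ : letI := DXs.catK; letI := DYs.catK; letI := DLocObj.dlocCategory X; letI := DLocObj.dlocCategory Y;
      ∀ j', ρ.toHom j' = (jEquivOfEq _ _ hHQ hNQ).symm (DLocObj.jIso α hI hΔ _ (φ.toHom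
        ((DLocObj.jIso α hI hΔ _).symm (jEquivOfEq _ _ hHP hNP j')))))
    (hφ : IsOFTypeRep φ) : IsOFTypeRep ρ := by
  letI := DXs.catK; letI := DYs.catK; letI := DLocObj.dlocCategory X; letI := DLocObj.dlocCategory Y
  -- the transported representative `ψα = j_Q ∘ φ ∘ j_P⁻¹` is of OF-type (T68-R2)
  have hα : IsOFTypeRep (φ.transport α hI hΔ) := ofRepsTransported_holds α hI hΔ _ _ φ hφ
  obtain ⟨⟨gens, hgens, hker⟩, -, -⟩ := hα
  obtain ⟨-, hopen, hfi⟩ := hφ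
  -- `ρ = e_Q⁻¹ ∘ ψα ∘ e_P`
  set eP := jEquivOfEq _ _ hHP hNP with heP
  set eQ := jEquivOfEq _ _ hHQ hNQ with heQ
  have hρ' : ∀ j', ρ.toHom j' = eQ.symm ((φ.transport α hI hΔ).toHom (eP j')) := fun j' => by
    rw [hρ, DLocObj.HomRep.transport_toHom_apply]
  refine ⟨⟨gens, ?_, ?_⟩, (rep_range_open_finiteIndex DXs DYs α hI hΔ hHP hNP hHQ hNQ hρ hopen hfi).1,
    (rep_range_open_finiteIndex DXs DYs α hI hΔ hHP hNP hHQ hNQ hρ hopen hfi).2⟩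
  · -- the generators, relative to `H_{P'} = α(H_P)`
    intro I hIg
    obtain ⟨I₀, h₀, hI₀⟩ := hgens I hIg
    exact ⟨I₀, h₀, by rw [hHP]; exact hI₀⟩
  · -- the kernel: `Ker ρ = e_P⁻¹(Ker ψα)`
    have hk : ρ.toHom.toMonoidHom.ker =
        (φ.transport α hI hΔ).toHom.toMonoidHom.ker.map eP.symm.toMulEquiv.toMonoidHom := by
      ext j'
      rw [MonoidHom.mem_ker]
      change ρ.toHom j' = 1 ↔ _
      rw [hρ', map_eq_one_iff _ eQ.symm.injective]
      constructor
      · intro h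
        exact ⟨eP j', (MonoidHom.mem_ker).2 h, eP.symm_apply_apply j'⟩
      · rintro ⟨j, hj, rfl⟩
        have : (φ.transport α hI hΔ).toHom j = 1 := hj
        change (φ.transport α hI hΔ).toHom (eP (eP.symm j)) = 1
        rwa [ContinuousMulEquiv.apply_symm_apply]
    rw [hk, hker, DLocObj.map_topologicalClosure_equiv,
      Subgroup.map_normalClosure _ eP.symm.toMulEquiv.toMonoidHom eP.symm.surjective]
    congr 2
    -- the generating sets correspond under `e_P⁻¹`
    have := image_jEquivOfEq_gens (DYs.pi1Functor.obj P') ((DXs.pi1Functor.obj P).transport α hI hΔ)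
      hHP hNP gens
    -- `this : eP '' S' = S`, want `eP.symm '' S = S'`
    change eP.symm '' _ = _
    rw [← this, ← Set.image_comp]
    convert Set.image_id _
    ext j
    exact eP.symm_apply_apply j

end OFType

/-! ### The tripod object is transported to a tripod object -/

section Tripod

variable {X Y : TemperedCurve p} (α : X.PiTemp ≃ₜ* Y.PiTemp)
  (hI : ∀ I : Subgroup X.PiTemp, X.IsCuspidalGeometricDecompositionGroup I →
    Y.IsCuspidalGeometricDecompositionGroup (I.map α.toMulEquiv.toMonoidHom))
  (hI' : ∀ I' : Subgroup Y.PiTemp, Y.IsCuspidalGeometricDecompositionGroup I' →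
    X.IsCuspidalGeometricDecompositionGroup (I'.map α.symm.toMulEquiv.toMonoidHom))
  (hΔ : X.DeltaTemp.map α.toMulEquiv.toMonoidHom = Y.DeltaTemp)

/-- `IsTripodObj` only depends on `(H, N)`. [cite: MochizukiGalSect2005, Cor 2.8 p.11] -/
theorem isTripodObj_congr {A B : DLocObj Y} (hH : A.H = B.H) (hN : A.N = B.N) (h : IsTripodObj Y A) :
    IsTripodObj Y B := by
  unfold IsTripodObj at h ⊢
  rw [← hH, ← hN]
  exact h

/-- `α(δ • I) = α(δ) • α(I)`. [cite: MochizukiSemiAnbd2006, Thm 6.8(ii) p.74] -/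
theorem map_smul_subgroup (δ : X.PiTemp) (I : Subgroup X.PiTemp) :
    (ConjAct.toConjAct δ • I).map α.toMulEquiv.toMonoidHom =
      ConjAct.toConjAct (α δ) • I.map α.toMulEquiv.toMonoidHom :=
  map_smul_eq α.toMulEquiv.toMonoidHom δ I

include hI hI' hΔ in
/-- **A tripod object goes to a tripod object** under the transport of objects along `α` ([GalSect] Cor. 2.8
proof p. 11: «both curves admit a [cuspidally split] tripod as an HPC»): `Δ^temp_Y = α(Δ^temp_X) ≤ α(H_T)`, and
the `Δ`-conjugacy classes of cuspidal geometric decomposition groups not contained in `N` correspond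
bijectively under `α` (Thm. 6.5 (iii) for `α` and `α⁻¹`). [cite: MochizukiGalSect2005, Cor 2.8 p.11] -/
theorem isTripodObj_transport (A : DLocObj X) (h : IsTripodObj X A) :
    IsTripodObj Y (A.transport α hI hΔ) := by
  obtain ⟨hΔA, I₁, I₂, I₃, ⟨h₁, hn₁⟩, ⟨h₂, hn₂⟩, ⟨h₃, hn₃⟩, h12, h13, h23, hall⟩ := h
  have hHN : (A.transport α hI hΔ).N = A.N.map α.toMulEquiv.toMonoidHom := rfl
  have hHH : (A.transport α hI hΔ).H = A.H.map α.toMulEquiv.toMonoidHom := rfl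
  -- not contained in `α(N)`
  have hnle : ∀ I : Subgroup X.PiTemp, ¬ I ≤ A.N →
      ¬ I.map α.toMulEquiv.toMonoidHom ≤ (A.transport α hI hΔ).N := by
    intro I hI0 hle
    apply hI0
    rw [hHN, Subgroup.map_le_map_iff_of_injective α.injective] at hle
    exact hle
  -- `Δ_Y`-conjugates come from `Δ_X`-conjugates
  have hconj : ∀ (I J : Subgroup X.PiTemp) (δ' : Y.DeltaTemp),
      ConjAct.toConjAct (δ' : Y.PiTemp) • I.map α.toMulEquiv.toMonoidHom = J.map α.toMulEquiv.toMonoidHom →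
      ∃ δ : X.DeltaTemp, ConjAct.toConjAct (δ : X.PiTemp) • I = J := by
    intro I J δ' hIJ
    have hδ' : (δ' : Y.PiTemp) ∈ X.DeltaTemp.map α.toMulEquiv.toMonoidHom := by rw [hΔ]; exact δ'.2
    obtain ⟨δ, hδ, hδe⟩ := hδ'
    refine ⟨⟨δ, hδ⟩, ?_⟩
    have : (ConjAct.toConjAct δ • I).map α.toMulEquiv.toMonoidHom = J.map α.toMulEquiv.toMonoidHom := by
      rw [map_smul_subgroup, ← hIJ]
      have hδe' : α δ = (δ' : Y.PiTemp) := hδe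
      rw [hδe']
    have := congrArg (fun K : Subgroup Y.PiTemp => K.map α.symm.toMulEquiv.toMonoidHom) this
    simpa only [DLocObj.map_map_symm] using this
  refine ⟨?_, I₁.map α.toMulEquiv.toMonoidHom, I₂.map α.toMulEquiv.toMonoidHom,
    I₃.map α.toMulEquiv.toMonoidHom, ⟨hI I₁ h₁, hnle I₁ hn₁⟩, ⟨hI I₂ h₂, hnle I₂ hn₂⟩, ⟨hI I₃ h₃, hnle I₃ hn₃⟩,
    ?_, ?_, ?_, ?_⟩
  · rw [hHH, ← hΔ]; exact Subgroup.map_mono hΔA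
  · intro δ' heq
    obtain ⟨δ, hδ⟩ := hconj I₁ I₂ δ' heq
    exact h12 δ hδ
  · intro δ' heq
    obtain ⟨δ, hδ⟩ := hconj I₁ I₃ δ' heq
    exact h13 δ hδ
  · intro δ' heq
    obtain ⟨δ, hδ⟩ := hconj I₂ I₃ δ' heq
    exact h23 δ hδ
  · intro I' hI'c hI'n
    -- `I' = α(I)` with `I` a cuspidal geometric decomposition group of `X` not contained in `N`
    set I := I'.map α.symm.toMulEquiv.toMonoidHom with hIdef
    have hIc : X.IsCuspidalGeometricDecompositionGroup I := hI' I' hI'c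
    have hII' : I.map α.toMulEquiv.toMonoidHom = I' := DLocObj.map_symm_map α I'
    have hIn : ¬ I ≤ A.N := by
      intro hle
      apply hI'n
      rw [← hII', hHN]
      exact Subgroup.map_mono hle
    obtain ⟨δ, hδ⟩ := hall I hIc hIn
    have hαδ : α (δ : X.PiTemp) ∈ Y.DeltaTemp := by rw [← hΔ]; exact ⟨δ, δ.2, rfl⟩
    refine ⟨⟨α δ, hαδ⟩, ?_⟩
    have key : ∀ J : Subgroup X.PiTemp, ConjAct.toConjAct (δ : X.PiTemp) • I = J →
        ConjAct.toConjAct (α (δ : X.PiTemp)) • I' = J.map α.toMulEquiv.toMonoidHom := by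
      intro J hJ
      rw [← hII', ← map_smul_subgroup, hJ]
    rcases hδ with hδ | hδ | hδ
    · exact Or.inl (key I₁ hδ)
    · exact Or.inr (Or.inl (key I₂ hδ))
    · exact Or.inr (Or.inr (key I₃ hδ))

end Tripod

end Thm68Sub

end Literature.AnabelianGeometry.SemiGraphs

end
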